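import Literature.NumberTheory.EllipticCurves.RationalIsogenyDegreesProofs
import HarnessLib

/-! # Radius `≤ 163` from Mazur's theorem and a covering barrier set — stub
# `stub_radius_of_mazur_of_barrier` of line `Sketch`, crux `MazurKenkuBound` (stmt-ABC-15125)

WHAT. The structural (set-cover) form of the Mazur–Kenku reduction, generic in the barrier set
`B : Finset ℕ`: if (i) every `d ∈ (163, 163²]` all of whose prime factors are Mazur primes has a
divisor in `B`, (ii) no cyclic `ℚ`-isogeny of an elliptic curve over `ℚ` has degree in `B`, and
(iii) Mazur 1978, Thm. 1 holds (tree fact `mazur_isogeny_irreducible`, taken as a hypothesis),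
then two `ℚ`-isogenous elliptic curves over `ℚ` are joined by a `ℚ`-isogeny of degree `≤ 163`.

SOURCE. Silverman, *AEC*, IX.6, Example 6.4 (the shape of the Mazur–Kenku argument); the proof
here is glue over the tree's cyclic-isogeny machinery (`RationalIsogenyDegreesProofs`).

DESIGN / PROOF. A cyclic isogeny `ψ : W → W'` exists (`IsIsogenous.exists_isCyclic`). If
`deg ψ > 163`, every prime factor of `deg ψ` is a Mazur prime
(`mem_mazurPrimes_of_prime_dvd_degree`), hence `≤ 163` (`le_of_mem_mazurPrimes`), so by the
elementary `exists_dvd_gt_le_sq` (the least divisor of `deg ψ` exceeding `163` is `≤ 163²`)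
`deg ψ` has a divisor `d₁ ∈ (163, 163²]`, which by (i) has a divisor `b ∈ B`; the divisor-closure
of cyclic degrees (`Isogeny.exists_isCyclic_degree_eq_of_dvd`) then yields a cyclic `ℚ`-isogeny
`W → W''` of degree `b`, excluded by (ii). -/

-- `Summit.<Summit>.<Problem>` is the mandated summit-side namespace (CONVENTIONS §2); for the
-- single-conjunct summit `ABC` the two coincide, so the duplicate `ABC.ABC` is deliberate.
set_option linter.dupNamespace false

noncomputable section

open WeierstrassCurve
open Literature.NumberTheory.EllipticCurves

namespace Summit.ABC.ABC.Theorems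

/-- Elementary: if `n > 163` and every prime factor of `n` is `≤ 163`, then `n` has a divisor `d`
with `163 < d ≤ 163²` — the least divisor of `n` exceeding `163`; were it `> 163²`, dividing it by
one of its prime factors `p ≤ 163` would give a smaller divisor of `n` still `> 163`. [folklore] -/
private theorem exists_dvd_gt_le_sq {n : ℕ} (hn : 163 < n)
    (hp : ∀ p : ℕ, p.Prime → p ∣ n → p ≤ 163) :
    ∃ d, d ∣ n ∧ 163 < d ∧ d ≤ 163 * 163 := by
  have hex : ∃ e, e ∣ n ∧ 163 < e := ⟨n, dvd_rfl, hn⟩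
  refine ⟨Nat.find hex, (Nat.find_spec hex).1, (Nat.find_spec hex).2, ?_⟩
  by_contra hgt
  rw [not_le] at hgt
  obtain ⟨hdn, hd⟩ := Nat.find_spec hex
  obtain ⟨p, hpp, hpd⟩ := Nat.exists_prime_and_dvd (show Nat.find hex ≠ 1 by omega)
  have hple : p ≤ 163 := hp p hpp (hpd.trans hdn)
  obtain ⟨m, hm⟩ := hpd
  have hmd : m ∣ Nat.find hex := Dvd.intro_left p hm.symm
  have hm163 : 163 < m := by
    by_contra hmle
    have := Nat.mul_le_mul hple (not_lt.mp hmle)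
    omega
  have hmlt : m < Nat.find hex := by
    rw [hm]
    exact lt_mul_of_one_lt_left (by omega) hpp.one_lt
  exact Nat.find_min hex hmlt ⟨hmd.trans hdn, hm163⟩

/-- **Radius from Mazur's theorem and a covering barrier set** (generic in `B`): if every
`mazurPrimes`-smooth `d ∈ (163, 163²]` has a divisor in `B`, no cyclic `ℚ`-isogeny of an elliptic
curve over `ℚ` has degree in `B`, and `ρ̄_{E,p}` is irreducible off Mazur's twelve primes
(`mazur_isogeny_irreducible`, Mazur 1978, Thm. 1, as a hypothesis), then two `ℚ`-isogenous
elliptic curves over `ℚ` are joined by a `ℚ`-isogeny of degree `≤ 163`. A cyclic isogeny between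
them exists (`IsIsogenous.exists_isCyclic`); if its degree exceeded `163`, its prime factors being
Mazur primes (`mem_mazurPrimes_of_prime_dvd_degree`), it would have a divisor in `(163, 163²]`,
hence one in `B`, and `Isogeny.exists_isCyclic_degree_eq_of_dvd` would produce an excluded cyclic
isogeny — the set-cover form of the Mazur–Kenku reduction of Silverman, *AEC*, IX.6, Example 6.4.
[cite: SilvermanAEC2009, IX.6 Example 6.4] -/
theorem stub_radius_of_mazur_of_barrier :
    ∀ B : Finset ℕ,
      (∀ d ∈ Finset.Ioc 163 (163 * 163), (∀ p ∈ d.primeFactors, p ∈ mazurPrimes) →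
        ∃ b ∈ B, b ∣ d) →
      (∀ (W W' : WeierstrassCurve ℚ) [W.IsElliptic] [W'.IsElliptic] (φ : Isogeny W W'),
        φ.IsCyclic → φ.degree ∉ B) →
      mazur_isogeny_irreducible →
      ∀ (W W' : WeierstrassCurve ℚ) [W.IsElliptic] [W'.IsElliptic], IsIsogenous W W' →
        ∃ φ : Isogeny W W', φ.degree ≤ 163 := by
  intro B hcov hexcl hM W W' _ _ hiso
  obtain ⟨ψ, hψ⟩ := hiso.exists_isCyclic
  refine ⟨ψ, ?_⟩
  by_contra hlt
  rw [not_le] at hlt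
  have hprime : ∀ p : ℕ, p.Prime → p ∣ ψ.degree → p ∈ mazurPrimes :=
    fun p hp hpd ↦ mem_mazurPrimes_of_prime_dvd_degree hM ψ hψ hp hpd
  obtain ⟨d₁, hd₁n, hlt₁, hle₁⟩ :=
    exists_dvd_gt_le_sq hlt fun p hp hpd ↦ le_of_mem_mazurPrimes (hprime p hp hpd)
  have hd₁primes : ∀ p ∈ d₁.primeFactors, p ∈ mazurPrimes := fun p hp ↦ by
    obtain ⟨hpp, hpd, -⟩ := Nat.mem_primeFactors.mp hp
    exact hprime p hpp (hpd.trans hd₁n)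
  obtain ⟨b, hbB, hbd⟩ := hcov d₁ (Finset.mem_Ioc.mpr ⟨hlt₁, hle₁⟩) hd₁primes
  obtain ⟨W'', hW'', χ, hχ, hχd, -⟩ := ψ.exists_isCyclic_degree_eq_of_dvd hψ (hbd.trans hd₁n)
  haveI := hW''
  exact hexcl W W'' χ hχ (hχd ▸ hbB)

end Summit.ABC.ABC.Theorems

end
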